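import Summits.BirchSwinnertonDyer.BirchSwinnertonDyer.Theorems.EisensteinDepletionAtTwoStarGO2KEtaSignCharacterA
import HarnessLib

/-!
# K2a: the `η` sign character — part B (§2 analytic: `L = Σ r_t log η(t·)`, `v = exp((3/2)L)`; §3 `etaSignCharacter`)
(crux `StarGO2Sigma`, stmt-BirchSwinnertonDyer-27046; planner bsd-rank2-p2 GEN 38 PART 12, split for the 400-line rule by the lead;
the print fact is the Literature named fact `dedekindEta_logTransformationLaw`).  See part A for §1 (arithmetic).
Nothing here reads `r_an`; `StarGO2Sigma` / E1M / BSD are NOT proved by this file.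
-/


set_option autoImplicit false
set_option linter.dupNamespace false

noncomputable section

namespace Summit.BirchSwinnertonDyer.BirchSwinnertonDyer.Theorems.DepletionAtTwo.KEta.EtaSign

open Literature.NumberTheory.ModularForms Literature.NumberTheory.EllipticCurves
  Literature.NumberTheory.EllipticCurves.ModularForms
open scoped MatrixGroups CongruenceSubgroup Manifold
open CongruenceSubgroup UpperHalfPlane

variable {N : ℕ} {β : ℕ → ℕ}

/-! ## §2 Analytic: `L(z) = Σ_t r_t log η(tz)` and the sign function `v = exp((3/2) L)` -/

/-- `L(z) = Σ_{t ∣ N} r_t · log η(tz)`. [cite: RademacherGrosswald1972, Ch. 4 A, eq. (60)] -/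
def logQuot (logEta : ℂ → ℂ) (N : ℕ) (r : ℕ → ℤ) (z : ℂ) : ℂ := ∑ t ∈ N.divisors, (r t : ℂ) * logEta (t * z)

/-- The sign function `v(τ) = exp((3/2)·L(τ))` (`v² = g̃³ = g_β`). [cite: Stevens1982, §2.5] -/
def signFn (logEta : ℂ → ℂ) (N : ℕ) (r : ℕ → ℤ) (τ : ℍ) : ℂ := Complex.exp ((3 / 2 : ℂ) * logQuot logEta N r τ)

variable {logEta : ℂ → ℂ}

/-- `v` is holomorphic on `ℍ`. [folklore] -/
theorem mdifferentiable_signFn (hd : DifferentiableOn ℂ logEta {z : ℂ | 0 < z.im}) (N : ℕ) (r : ℕ → ℤ) :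
    MDiff (signFn logEta N r) := by
  rw [UpperHalfPlane.mdifferentiable_iff]
  have hL : DifferentiableOn ℂ (fun z ↦ Complex.exp ((3 / 2 : ℂ) * logQuot logEta N r z)) {z : ℂ | 0 < z.im} := by
    refine (DifferentiableOn.const_mul ?_ _).cexp
    unfold logQuot
    refine DifferentiableOn.fun_sum fun t ht ↦ DifferentiableOn.const_mul ?_ _
    refine hd.comp ((differentiableOn_const _).mul differentiableOn_id) fun z hz ↦ ?_
    exact im_natMul_pos (Nat.pos_of_mem_divisors ht) hz
  exact hL.congr fun z hz ↦ by
    simp only [Function.comp_apply, signFn, ofComplex_apply_of_im_pos hz, UpperHalfPlane.coe_mk]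

/-- `exp(L(z)) = ∏ η(tz)^{r_t}` for `Im z > 0`. [folklore] -/
theorem exp_logQuot (hexp : ∀ z : ℂ, 0 < z.im → Complex.exp (logEta z) = ModularForm.eta z) (N : ℕ) (r : ℕ → ℤ)
    (τ : ℍ) : Complex.exp (logQuot logEta N r τ) = etaQuotient N r τ := by
  rw [logQuot, Complex.exp_sum, etaQuotient_apply]
  refine Finset.prod_congr rfl fun t ht ↦ ?_
  rw [Complex.exp_int_mul, hexp _ (im_natMul_pos (Nat.pos_of_mem_divisors ht) τ.2)]

/-- `v² = g̃³`. [folklore] -/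
theorem signFn_sq (hexp : ∀ z : ℂ, 0 < z.im → Complex.exp (logEta z) = ModularForm.eta z) (N : ℕ) (r : ℕ → ℤ)
    (τ : ℍ) : signFn logEta N r τ ^ 2 = etaQuotient N r τ ^ 3 := by
  unfold signFn
  rw [sq, ← Complex.exp_add, show (3 / 2 : ℂ) * logQuot logEta N r τ + 3 / 2 * logQuot logEta N r τ =
    ((3 : ℤ) : ℂ) * logQuot logEta N r τ by push_cast; ring, Complex.exp_int_mul, exp_logQuot hexp, zpow_ofNat]

/-- `Σ_t r_t = 0` for `r_t = N c_t`. [cite: Stevens1982, §2.4] -/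
theorem sum_expVec_eq_zero (hN : N ≠ 0) (hadm : IsAdmissibleStabData N β) {r : ℕ → ℤ}
    (hr : ∀ t ∈ N.divisors, (r t : ℚ) = N * stabCoeff N β t) : ∑ t ∈ N.divisors, (r t : ℂ) = 0 := by
  have h : ∑ t ∈ N.divisors, (r t : ℚ) = 0 := by
    rw [Finset.sum_congr rfl fun t ht ↦ hr t ht, ← Finset.mul_sum, sum_divisors_stabCoeff_eq_zero hN hadm, mul_zero]
  have e : ∑ t ∈ N.divisors, (r t : ℂ) = ((∑ t ∈ N.divisors, (r t : ℚ) : ℚ) : ℂ) := by push_cast; rfl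
  rw [e, h, Rat.cast_zero]

/-- `Σ_t t·r_t = 0` for `r_t = N c_t`. [cite: Stevens1982, §2.4] -/
theorem sum_mul_expVec_eq_zero (hN : N ≠ 0) (hadm : IsAdmissibleStabData N β) {r : ℕ → ℤ}
    (hr : ∀ t ∈ N.divisors, (r t : ℚ) = N * stabCoeff N β t) : ∑ t ∈ N.divisors, (t : ℂ) * (r t : ℂ) = 0 := by
  have h : ∑ t ∈ N.divisors, (t : ℚ) * (r t : ℚ) = 0 := by
    rw [Finset.sum_congr rfl fun (t : ℕ) ht ↦ show (t : ℚ) * (r t : ℚ) = N * (stabCoeff N β t * t) by rw [hr t ht]; ring,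
      ← Finset.mul_sum, sum_divisors_stabCoeff_mul_self_eq_zero hN hadm, mul_zero]
  have e : ∑ t ∈ N.divisors, (t : ℂ) * (r t : ℂ) = ((∑ t ∈ N.divisors, (t : ℚ) * (r t : ℚ) : ℚ) : ℂ) := by
    push_cast; rfl
  rw [e, h, Rat.cast_zero]

/-- `Σ_t r_t Φ(a, tb; c/t, d) = N·φ_β(a b; c d)` for `r_t = N c_t`. [cite: Stevens1982, §2.5 (PDF p. 38)] -/
theorem sum_expVec_mul_rademacherPhi {r : ℕ → ℤ} (hr : ∀ t ∈ N.divisors, (r t : ℚ) = N * stabCoeff N β t)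
    (a b c d : ℤ) :
    ∑ t ∈ N.divisors, (r t : ℂ) * ((rademacherPhi a (t * b) (c / t) d : ℚ) : ℂ) =
      (((N : ℚ) * stabEisensteinPeriod N β a b c d : ℚ) : ℂ) := by
  have h : ∑ t ∈ N.divisors, (r t : ℚ) * rademacherPhi a (t * b) (c / t) d = N * stabEisensteinPeriod N β a b c d := by
    rw [stabEisensteinPeriod_eq, Finset.mul_sum]
    refine Finset.sum_congr rfl fun t ht ↦ ?_
    rw [hr t ht]; ring
  rw [← h]; push_cast; rfl

/-- **Dedekind's law summed over `t ∣ N`** (`c > 0`, `N ∣ c`): `L(γz) = L(z) + πi·N φ_β(γ)/12` — the `log(cz+d)` terms cancel by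
`Σ r_t = 0`. [cite: RademacherGrosswald1972, Ch. 4 A, eq. (60)] [cite: Stevens1982, §2.5] -/
theorem logQuot_moebius_of_pos
    (hlaw : ∀ a b c d : ℤ, a * d - b * c = 1 → 0 < c → ∀ z : ℂ, 0 < z.im →
      logEta ((a * z + b) / (c * z + d)) =
        logEta z + Complex.log (c * z + d) / 2 + Real.pi * Complex.I * (((rademacherPhi a b c d : ℚ) : ℂ) - 3) / 12)
    (hN : N ≠ 0) (hadm : IsAdmissibleStabData N β) {r : ℕ → ℤ} (hr : ∀ t ∈ N.divisors, (r t : ℚ) = N * stabCoeff N β t)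
    {a b c d : ℤ} (hdet : a * d - b * c = 1) (hc : 0 < c) (hNc : (N : ℤ) ∣ c) (τ : ℍ) :
    logQuot logEta N r ((a * (τ : ℂ) + b) / (c * (τ : ℂ) + d)) =
      logQuot logEta N r τ + Real.pi * Complex.I * (((N : ℚ) * stabEisensteinPeriod N β a b c d : ℚ) : ℂ) / 12 := by
  unfold logQuot
  have key : ∀ t ∈ N.divisors, (r t : ℂ) * logEta (t * ((a * (τ : ℂ) + b) / (c * (τ : ℂ) + d))) =
      (r t : ℂ) * logEta (t * (τ : ℂ)) + (Complex.log (c * (τ : ℂ) + d) / 2 - Real.pi * Complex.I * 3 / 12) * (r t : ℂ) +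
        Real.pi * Complex.I / 12 * ((r t : ℂ) * ((rademacherPhi a (t * b) (c / t) d : ℚ) : ℂ)) := by
    intro t ht
    have ht0 : 0 < t := Nat.pos_of_mem_divisors ht
    have htc : (t : ℤ) ∣ c := dvd_trans (Int.natCast_dvd_natCast.mpr (Nat.dvd_of_mem_divisors ht)) hNc
    have hmul : (t : ℤ) * (c / t) = c := Int.mul_ediv_cancel' htc
    have hct : ((c / t : ℤ) : ℂ) * (t : ℂ) = c := by
      rw [mul_comm]; exact_mod_cast hmul
    have hpos : 0 < c / t := by
      have h : 0 < (t : ℤ) * (c / t) := by rwa [hmul]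
      exact (mul_pos_iff_of_pos_left (by exact_mod_cast ht0)).mp h
    have hdet' : a * d - (t * b) * (c / t) = 1 := by
      rw [show (t : ℤ) * b * (c / t) = b * ((t : ℤ) * (c / t)) by ring, hmul]; exact hdet
    have him : 0 < ((t : ℂ) * (τ : ℂ)).im := im_natMul_pos ht0 τ.2
    have hden : ((c / t : ℤ) : ℂ) * ((t : ℂ) * (τ : ℂ)) + d = c * (τ : ℂ) + d := by rw [← mul_assoc, hct]
    have harg : (t : ℂ) * ((a * (τ : ℂ) + b) / (c * (τ : ℂ) + d)) =
        (a * ((t : ℂ) * (τ : ℂ)) + ((t * b : ℤ) : ℂ)) / (((c / t : ℤ) : ℂ) * ((t : ℂ) * (τ : ℂ)) + d) := by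
      rw [hden]; push_cast; ring
    rw [harg, hlaw a (t * b) (c / t) d hdet' hpos _ him, hden]
    ring
  rw [Finset.sum_congr rfl key, Finset.sum_add_distrib, Finset.sum_add_distrib, ← Finset.mul_sum, ← Finset.mul_sum,
    sum_expVec_eq_zero hN hadm hr, sum_expVec_mul_rademacherPhi hr, mul_zero, add_zero]
  ring

/-- **Translations**: `L(z + k) = L(z)` for `k ∈ ℤ` — the terms `πi t k/12` cancel by `Σ t r_t = 0`.
[cite: RademacherGrosswald1972, Ch. 4 A, eq. (57a)] [cite: Stevens1982, §2.4] -/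
theorem logQuot_add_int (htr : ∀ z : ℂ, 0 < z.im → ∀ b : ℤ, logEta (z + b) = logEta z + Real.pi * Complex.I * b / 12)
    (hN : N ≠ 0) (hadm : IsAdmissibleStabData N β) {r : ℕ → ℤ} (hr : ∀ t ∈ N.divisors, (r t : ℚ) = N * stabCoeff N β t)
    (τ : ℍ) (k : ℤ) : logQuot logEta N r ((τ : ℂ) + k) = logQuot logEta N r τ := by
  unfold logQuot
  have key : ∀ t ∈ N.divisors, (r t : ℂ) * logEta (t * ((τ : ℂ) + k)) =
      (r t : ℂ) * logEta (t * (τ : ℂ)) + Real.pi * Complex.I * k / 12 * ((t : ℂ) * (r t : ℂ)) := by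
    intro t ht
    have him : 0 < ((t : ℂ) * (τ : ℂ)).im := im_natMul_pos (Nat.pos_of_mem_divisors ht) τ.2
    rw [mul_add, show (t : ℂ) * (k : ℂ) = ((t * k : ℤ) : ℂ) by push_cast; ring, htr _ him]
    push_cast; ring
  rw [Finset.sum_congr rfl key, Finset.sum_add_distrib, ← Finset.mul_sum, sum_mul_expVec_eq_zero hN hadm hr, mul_zero,
    add_zero]

/-- `↑(γ•τ) = (aτ + b)/(cτ + d)` with integer entries. [folklore] -/
theorem coe_smul_eq (γ : SL(2, ℤ)) (τ : ℍ) :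
    ((γ • τ : ℍ) : ℂ) = ((γ 0 0 : ℤ) * (τ : ℂ) + (γ 0 1 : ℤ)) / ((γ 1 0 : ℤ) * (τ : ℂ) + (γ 1 1 : ℤ)) := by
  rw [UpperHalfPlane.coe_specialLinearGroup_apply]
  simp

/-- The exponential of the period term is the sign: `exp((3/2)·πi·(8 M₀ n)/12) = (−1)^n` for `M₀` odd. [folklore] -/
theorem exp_period_term {M₀ : ℤ} (hM₀ : Odd M₀) (n : ℤ) :
    Complex.exp ((3 / 2 : ℂ) * (Real.pi * Complex.I * (((8 * M₀ * n : ℚ)) : ℂ) / 12)) = (-1 : ℂ) ^ n := by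
  rw [show (3 / 2 : ℂ) * (Real.pi * Complex.I * (((8 * M₀ * n : ℚ)) : ℂ) / 12) = ((M₀ * n : ℤ) : ℂ) * (Real.pi * Complex.I) by
    push_cast; ring, Complex.exp_int_mul, Complex.exp_pi_mul_I, zpow_mul, hM₀.neg_one_zpow]

/-! ## §3 K2a: the η sign character -/

/-- **K2a `stub_etaSignCharacter` (THEOREM B(i)) from Dedekind's `log η` law**: for `N` odd, `β` admissible, `r_t = N c_t`, and a
generator `g'` of the value group `φ_β(Γ₀(N)) = ℤg'`, the function `v = exp((3/2) Σ_t r_t log η(tτ))` is holomorphic on `ℍ`, satisfies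
`v² = (∏ η(tτ)^{r_t})³`, and `v(γτ) = (−1)^n v(τ)` whenever `γ ∈ Γ₀(N)`, `φ_β(γ) = n g'`.  Literally the body of `IsEtaSignFn N β r
g' 3 v` of the v7 design (HOME/p2/g38/lean/KummerV7Sketch.lean), so `stub_etaSignCharacter` follows by `exact ⟨3, v, …⟩`.
[cite: RademacherGrosswald1972, Ch. 4 A, eq. (57a), (60)] [cite: Stevens1982, §2.4–2.5, §5.4] -/
theorem etaSignCharacter (H : dedekindEta_logTransformationLaw) (N : ℕ) (β : ℕ → ℕ) (r : ℕ → ℤ) (hodd : Odd N)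
    (hadm : IsAdmissibleStabData N β) (hr : ∀ t ∈ N.divisors, (r t : ℚ) = N * stabCoeff N β t) (g' : ℚ)
    (hgen : ∀ x : ℚ, (∃ γ : Gamma0 N, stabEisensteinPeriod N β ((γ : SL(2, ℤ)) 0 0) ((γ : SL(2, ℤ)) 0 1)
      ((γ : SL(2, ℤ)) 1 0) ((γ : SL(2, ℤ)) 1 1) = x) ↔ ∃ n : ℤ, x = n * g') :
    ∃ (s : ℕ) (v : ℍ → ℂ), Odd s ∧ MDiff v ∧ (∀ τ : ℍ, v τ ^ 2 = etaQuotient N r τ ^ s) ∧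
      ∀ γ : SL(2, ℤ), γ ∈ Gamma0 N → ∀ n : ℤ,
        stabEisensteinPeriod N β (γ 0 0) (γ 0 1) (γ 1 0) (γ 1 1) = n * g' → ∀ τ : ℍ, v (γ • τ) = (-1 : ℂ) ^ n * v τ := by
  obtain ⟨logEta, hd, hexp, htr, hlaw⟩ := H
  obtain ⟨M₀, hM₀odd, hM₀⟩ := exists_odd_generator hodd hadm g' hgen
  have hN : N ≠ 0 := fun h ↦ by simp [h] at hodd
  refine ⟨3, signFn logEta N r, ⟨1, rfl⟩, mdifferentiable_signFn hd N r, fun τ ↦ signFn_sq hexp N r τ, ?_⟩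
  -- the case `c > 0` for arbitrary integer entries
  have hposcase : ∀ (a b c d : ℤ), a * d - b * c = 1 → 0 < c → (N : ℤ) ∣ c → ∀ n : ℤ,
      stabEisensteinPeriod N β a b c d = n * g' → ∀ τ : ℍ,
        Complex.exp ((3 / 2 : ℂ) * logQuot logEta N r ((a * (τ : ℂ) + b) / (c * (τ : ℂ) + d))) =
          (-1 : ℂ) ^ n * Complex.exp ((3 / 2 : ℂ) * logQuot logEta N r τ) := by
    intro a b c d hdet hc hNc n hn τ
    have hNφ : (N : ℚ) * stabEisensteinPeriod N β a b c d = 8 * M₀ * n := by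
      rw [hn]; linear_combination (n : ℚ) * hM₀
    rw [logQuot_moebius_of_pos hlaw hN hadm hr hdet hc hNc τ, hNφ, mul_add, Complex.exp_add, exp_period_term hM₀odd, mul_comm]
  intro γ hγ n hn τ
  have hNc : (N : ℤ) ∣ γ 1 0 := (ZMod.intCast_zmod_eq_zero_iff_dvd _ _).mp (Gamma0_mem.mp hγ)
  have hdet : γ 0 0 * γ 1 1 - γ 0 1 * γ 1 0 = 1 := by
    have := Matrix.SpecialLinearGroup.det_coe γ
    rw [Matrix.det_fin_two] at this
    linear_combination this
  show Complex.exp ((3 / 2 : ℂ) * logQuot logEta N r ((γ • τ : ℍ) : ℂ)) =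
    (-1 : ℂ) ^ n * Complex.exp ((3 / 2 : ℂ) * logQuot logEta N r τ)
  rcases lt_trichotomy 0 (γ 1 0) with hc | hc | hc
  · -- `c > 0`
    rw [coe_smul_eq]
    exact hposcase _ _ _ _ hdet hc hNc n hn τ
  · -- `c = 0`: `γ = ±T^k`, `φ_β(γ) = 0`, `n = 0`, `L(τ + k) = L(τ)`
    have hφ0 : stabEisensteinPeriod N β (γ 0 0) (γ 0 1) (γ 1 0) (γ 1 1) = 0 := by
      rw [← hc, period_of_c_eq_zero hN hadm]
    have hg0 : g' ≠ 0 := by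
      intro h
      rw [h, mul_zero] at hM₀
      have h0 : (M₀ : ℚ) = 0 := by linarith
      have hM : M₀ = 0 := by exact_mod_cast h0
      obtain ⟨k, hk⟩ := hM₀odd
      omega
    have hn0 : n = 0 := by
      rw [hφ0] at hn
      have : (n : ℚ) = 0 := by
        rcases mul_eq_zero.mp hn.symm with h | h
        · exact h
        · exact absurd h hg0
      exact_mod_cast this
    subst hn0
    have had : γ 0 0 * γ 1 1 = 1 := by rw [← hc, mul_zero, sub_zero] at hdet; exact hdet
    rw [zpow_zero, one_mul, coe_smul_eq, ← hc]
    rcases Int.eq_one_or_neg_one_of_mul_eq_one' had with ⟨ha, hd'⟩ | ⟨ha, hd'⟩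
    · rw [ha, hd', show (((1 : ℤ) : ℂ) * (τ : ℂ) + ((γ 0 1 : ℤ) : ℂ)) / (((0 : ℤ) : ℂ) * (τ : ℂ) + ((1 : ℤ) : ℂ)) =
        (τ : ℂ) + ((γ 0 1 : ℤ) : ℂ) by push_cast; ring, logQuot_add_int htr hN hadm hr τ]
    · rw [ha, hd', show (((-1 : ℤ) : ℂ) * (τ : ℂ) + ((γ 0 1 : ℤ) : ℂ)) / (((0 : ℤ) : ℂ) * (τ : ℂ) + ((-1 : ℤ) : ℂ)) =
        (τ : ℂ) + ((-γ 0 1 : ℤ) : ℂ) by push_cast; ring, logQuot_add_int htr hN hadm hr τ]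
  · -- `c < 0`: pass to `−γ` (same Möbius transformation, `Φ(−M) = Φ(M)`)
    have e : γ • τ = (-γ) • τ := (ModularGroup.SL_neg_smul γ τ).symm
    have h00 : ((-γ : SL(2, ℤ)) 0 0) = -(γ 0 0) := by simp
    have h01 : ((-γ : SL(2, ℤ)) 0 1) = -(γ 0 1) := by simp
    have h10 : ((-γ : SL(2, ℤ)) 1 0) = -(γ 1 0) := by simp
    have h11 : ((-γ : SL(2, ℤ)) 1 1) = -(γ 1 1) := by simp
    rw [e, coe_smul_eq, h00, h01, h10, h11]
    have hn' : stabEisensteinPeriod N β (-γ 0 0) (-γ 0 1) (-γ 1 0) (-γ 1 1) = n * g' := by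
      rw [CuspEvenness.stabEisensteinPeriod_neg_of_dvd hNc]; exact hn
    exact hposcase _ _ _ _ (by linear_combination hdet) (by linarith) (dvd_neg.mpr hNc) n hn' τ

end Summit.BirchSwinnertonDyer.BirchSwinnertonDyer.Theorems.DepletionAtTwo.KEta.EtaSign

end
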